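import Summits.Ventures.CertifiedArithmetic.LowPrec.RoundToOdd

/-!
# Round to odd makes every narrowing innocuous: `RN_φ ∘ RO_ψ = RN_φ` for `m_ψ ≥ m_φ + 2`

HONEST FRAMING (venture CertifiedArithmetic / cell `pub-lowprec`): certified error envelopes and
provably optimal rounding/accumulation schemes for low-precision formats under stated cost models;
every table by two implementations; no hardware or vendor claims.

`DoubleRounding.lean` / `DoubleRoundingVerdicts*.lean` settled WHEN a round-to-nearest-even
intermediate is harmless (sums of `φ`-data through `ψ` with `p_ψ ≥ 2p_φ + 1`; E4M3 via bfloat16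
is NOT: `9/8 + 15/256 ↦ 5/4` instead of `9/8`). The classical remedy is to compute the wide
intermediate with ROUND TO ODD [BoldoMelquiond2008, Algorithm 1 and Thm 3 (To_Odd_Even_is_Even):
"assuming `p ≥ 2`, `k ≥ 2`, `E_e ≥ 2 + E_w`: `∘_p(□^odd_{p+k}(x)) = ∘_p(x)`", Coq-proved for
unbounded exponents], surveyed in [BoldoEtAl2023, §2.10.2].

THEOREM (`MiniFloat.toRat_roundNE_roundOdd`), for the venture's SATURATING formats: if
`m_φ + 2 ≤ m_ψ`, `bias_φ ≤ bias_ψ` and `maxRat φ ≤ maxRat ψ`, then for EVERY rational `s` with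
`|s| ≤ maxRat ψ` (no overflow of the wide intermediate): `fl_φ(RO_ψ(s)) = fl_φ(s)` as values —
ANY real-valued quantity (sums, products, dot products, conversions, arbitrary reals), not only
sums of narrow data, subnormals of both formats and saturation of `φ` included. Proof
= `DoubleRounding.lean`'s bracket argument with the arithmetic core replaced by PARITY: the only
harmful wide value is the midpoint of two consecutive `φ`-values, which is EVEN in `ψ`
(`two_dvd_man_of_toRat_eq_midpoint`), while an inexact round-to-odd result is ODD.

Verdicts (hypotheses are three numeral comparisons, `decide`): E4M3 and E5M2 via bfloat16 or
binary16 or binary32; bfloat16 and binary16 via binary32; FP6/FP4 via E4M3/E5M2/bfloat16/…; and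
the kernel replay of the RNE counterexample: `RO_bf16(303/256) = 151/128 ↦ 9/8 = fl_E4M3(303/256)`.
What this file does NOT claim: anything about hardware support for RO (IEEE 754 does not specify
it; [BoldoMelquiond2008, §III.B] gives the `RZ`-plus-sticky-bit implementation).
-/

namespace Literature.ComputerArithmetic.FloatingPoint

namespace MiniFloat

open Format

variable {φ ψ : Format}

/-! ### The theorem -/

/-- Positive inputs: `fl_φ(RO_ψ(s)) = fl_φ(s)` for `0 < s ≤ maxRat ψ`.
[cite: BoldoMelquiond2008, Thm 3] -/
theorem toRat_roundNE_roundOddPos (hm : φ.manBits + 2 ≤ ψ.manBits) (hb : φ.bias ≤ ψ.bias)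
    (hmax : φ.maxRat ≤ ψ.maxRat) {s : ℚ} (hs : 0 < s) (hsψ : s ≤ ψ.maxRat) :
    (roundNE φ (roundOddPos ψ s).toRat).toRat = (roundNE φ s).toRat := by
  have hqφ := φ.quantum_pos
  have hmle : φ.manBits ≤ ψ.manBits := by omega
  have hmψ : 1 ≤ ψ.manBits := by omega
  have hq : ψ.qexp ≤ φ.qexp := qexp_le_of_le hmle hb
  have hsabs : |s| ≤ ψ.maxRat := by rw [abs_of_pos hs]; exact hsψ
  by_cases hex : ∃ z : MiniFloat ψ, z.toRat = s
  · rw [toRat_roundOddPos_of_exists hsabs hex]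
  by_cases hbig : φ.maxRat ≤ s
  · -- both roundings into `φ` saturate
    obtain ⟨z, hz⟩ : ∃ z : MiniFloat ψ, z.toRat = φ.maxRat := by
      obtain ⟨z, hz⟩ := exists_toRat_eq_of_le hmle hq hmax (top φ)
      exact ⟨z, by rw [hz, toRat_top]⟩
    have hw : φ.maxRat ≤ (roundOddPos ψ s).toRat := by
      rw [← hz]; exact le_roundOddPos_of_le hsabs z (by rw [hz]; exact hbig)
    rw [toRat_roundNE_of_maxRat_le_pos hw, toRat_roundNE_of_maxRat_le_pos hbig]
  have hbig' : s < φ.maxRat := not_le.mp hbig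
  have hnsφ : ¬ ∃ y : MiniFloat φ, y.toRat = s := by
    rintro ⟨y, hy⟩
    obtain ⟨z, hz⟩ := exists_toRat_eq_of_le hmle hq hmax y
    exact hex ⟨z, hz.trans hy⟩
  obtain ⟨hv0, hvs, hsu, ⟨u, hu⟩, hgap⟩ := roundDown_bracket hs hbig' hnsφ
  set v := roundDown φ s with hv_def
  set G := 2 ^ (v.expCode - 1) * φ.quantum with hG_def
  have hG : 0 < G := by positivity
  obtain ⟨zv, hzv⟩ : ∃ z : MiniFloat ψ, z.toRat = v.toRat := exists_toRat_eq_of_le hmle hq hmax v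
  obtain ⟨zu, hzu⟩ : ∃ z : MiniFloat ψ, z.toRat = v.toRat + G := by
    obtain ⟨z, hz⟩ := exists_toRat_eq_of_le hmle hq hmax u
    exact ⟨z, hz.trans hu⟩
  obtain ⟨zM, hzM⟩ : ∃ z : MiniFloat ψ, z.toRat = v.toRat + G / 2 :=
    exists_toRat_eq_midpoint (by omega) hb hmax hv0 hu
  have hsM : s ≠ v.toRat + G / 2 := by
    intro h; exact hex ⟨zM, hzM.trans h.symm⟩
  -- the wide round-to-odd result: inexact, hence ODD, hence not the (even) midpoint
  set w := (roundOddPos ψ s).toRat with hw_def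
  have hws : w ≠ s := fun h => hex ⟨_, h⟩
  have hodd := not_two_dvd_man_roundOddPos hmψ hs (lt_of_lt_of_le hbig' hmax) hws
  have hwM : w ≠ v.toRat + G / 2 := by
    intro h
    refine hodd (two_dvd_man_of_toRat_eq_midpoint hm hb hv0 (roundOddPos ψ s) ?_)
    rw [← hw_def, h, hG_def]
  rcases lt_or_gt_of_ne hsM with hlt | hgt
  · -- `s < M`: `w ∈ [v, M)`, both round to `v`
    have hwv : v.toRat ≤ w := by
      rw [← hzv]; exact le_roundOddPos_of_le hsabs zv (by rw [hzv]; exact hvs.le)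
    have hwM' : w ≤ v.toRat + G / 2 := by
      rw [← hzM]; exact roundOddPos_le_of_le hsabs zM (by rw [hzM]; exact hlt.le)
    have hwLt : w < v.toRat + G / 2 := lt_of_le_of_ne hwM' hwM
    rw [toRat_roundNE_eq_of_forall_lt ⟨v, rfl⟩ (forall_lt_of_mem_low hgap hwv hwLt),
      toRat_roundNE_eq_of_forall_lt ⟨v, rfl⟩ (forall_lt_of_mem_low hgap hvs.le hlt)]
  · -- `s > M`: `w ∈ (M, v + G]`, both round to `v + G`
    have hwu : w ≤ v.toRat + G := by
      rw [← hzu]; exact roundOddPos_le_of_le hsabs zu (by rw [hzu]; exact hsu.le)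
    have hwM' : v.toRat + G / 2 ≤ w := by
      rw [← hzM]; exact le_roundOddPos_of_le hsabs zM (by rw [hzM]; exact hgt.le)
    have hwGt : v.toRat + G / 2 < w := lt_of_le_of_ne hwM' (Ne.symm hwM)
    rw [toRat_roundNE_eq_of_forall_lt ⟨u, rfl⟩ (forall_lt_of_mem_high hu hgap hwGt hwu),
      toRat_roundNE_eq_of_forall_lt ⟨u, rfl⟩ (forall_lt_of_mem_high hu hgap hgt hsu.le)]

/-- **ROUND TO ODD IS INNOCUOUS FOR EVERY NARROWING WITH TWO SPARE BITS**: for formats `φ`, `ψ`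
with `m_φ + 2 ≤ m_ψ`, `bias_φ ≤ bias_ψ`, `maxRat φ ≤ maxRat ψ`, and EVERY rational `s` with
`|s| ≤ maxRat ψ`: `fl_φ(RO_ψ(s)) = fl_φ(s)` as values (`fl_φ` = saturating round-to-nearest-even,
`RO_ψ` = round to odd; subnormals and saturation included). [cite: BoldoMelquiond2008, Thm 3] -/
theorem toRat_roundNE_roundOdd (hm : φ.manBits + 2 ≤ ψ.manBits) (hb : φ.bias ≤ ψ.bias)
    (hmax : φ.maxRat ≤ ψ.maxRat) {s : ℚ} (hsψ : |s| ≤ ψ.maxRat) :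
    (roundNE φ (roundOdd ψ s).toRat).toRat = (roundNE φ s).toRat := by
  rcases lt_trichotomy 0 s with hpos | h0 | hneg
  · rw [roundOdd_of_nonneg hpos.le]
    exact toRat_roundNE_roundOddPos hm hb hmax hpos (le_trans (le_abs_self s) hsψ)
  · subst h0
    rw [roundOdd_of_nonneg le_rfl, toRat_roundOddPos_zero]
  · have hs' : 0 < -s := by linarith
    have habs' : -s ≤ ψ.maxRat := by rw [abs_of_neg hneg] at hsψ; exact hsψ
    have h := toRat_roundNE_roundOddPos hm hb hmax hs' habs'
    rw [← roundOdd_of_nonneg hs'.le, toRat_roundOdd_neg, toRat_roundNE_neg, toRat_roundNE_neg,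
      neg_inj] at h
    exact h

/-- Corollary for data: a quantity `s` of magnitude at most `maxRat ψ` computed with ONE
round-to-odd rounding into `ψ` and then converted to `φ` equals the correctly rounded `φ`-result;
in particular for the SUM of two `φ`-data (the case `DoubleRoundingVerdicts` decides for RNE
intermediates), whenever `2·maxRat φ ≤ maxRat ψ`. [cite: BoldoMelquiond2008, Thm 3] -/
theorem toRat_roundNE_roundOdd_add (hm : φ.manBits + 2 ≤ ψ.manBits) (hb : φ.bias ≤ ψ.bias)
    (hmax2 : 2 * φ.maxRat ≤ ψ.maxRat) (a b : MiniFloat φ) :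
    (roundNE φ (roundOdd ψ (a.toRat + b.toRat)).toRat).toRat = (roundNE φ (a.toRat + b.toRat)).toRat := by
  have hmr : 0 ≤ φ.maxRat := mul_nonneg (Nat.cast_nonneg _) φ.quantum_pos.le
  refine toRat_roundNE_roundOdd hm hb (by linarith) ?_
  calc |a.toRat + b.toRat| ≤ |a.toRat| + |b.toRat| := abs_add_le _ _
    _ ≤ φ.maxRat + φ.maxRat := add_le_add (abs_toRat_le_maxRat a) (abs_toRat_le_maxRat b)
    _ ≤ ψ.maxRat := by linarith

/-! ### Verdicts for the named formats (hypotheses by `decide`) -/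

/-- E4M3 via bfloat16 WITH ROUND TO ODD is innocuous (`3 + 2 ≤ 7`), for every `|s| ≤ maxRat bf16` —
whereas with an RNE bfloat16 intermediate it is not (`DoubleRoundingVerdicts`). -/
theorem E4M3_via_BFloat16_roundOdd {s : ℚ} (hs : |s| ≤ BFloat16.maxRat) :
    (roundNE E4M3 (roundOdd BFloat16 s).toRat).toRat = (roundNE E4M3 s).toRat :=
  toRat_roundNE_roundOdd (by decide) (by decide) (by decide +kernel) hs

/-- E5M2 via bfloat16 with round to odd is innocuous (`2 + 2 ≤ 7`). -/
theorem E5M2_via_BFloat16_roundOdd {s : ℚ} (hs : |s| ≤ BFloat16.maxRat) :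
    (roundNE E5M2 (roundOdd BFloat16 s).toRat).toRat = (roundNE E5M2 s).toRat :=
  toRat_roundNE_roundOdd (by decide) (by decide) (by decide +kernel) hs

/-- E4M3 via binary16 with round to odd is innocuous (`3 + 2 ≤ 10`). -/
theorem E4M3_via_Binary16_roundOdd {s : ℚ} (hs : |s| ≤ Binary16.maxRat) :
    (roundNE E4M3 (roundOdd Binary16 s).toRat).toRat = (roundNE E4M3 s).toRat :=
  toRat_roundNE_roundOdd (by decide) (by decide) (by decide +kernel) hs

/-- E5M2 via binary16 with round to odd is innocuous (`2 + 2 ≤ 10`). -/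
theorem E5M2_via_Binary16_roundOdd {s : ℚ} (hs : |s| ≤ Binary16.maxRat) :
    (roundNE E5M2 (roundOdd Binary16 s).toRat).toRat = (roundNE E5M2 s).toRat :=
  toRat_roundNE_roundOdd (by decide) (by decide) (by decide +kernel) hs

/-- bfloat16 via binary32 with round to odd is innocuous (`7 + 2 ≤ 23`): e.g. an fp32
accumulation finished by ONE round-to-odd and a bf16 store delivers the correctly rounded bf16
value of the exact fp32-representable-range quantity it was given. -/
theorem BFloat16_via_Binary32_roundOdd {s : ℚ} (hs : |s| ≤ Binary32.maxRat) :
    (roundNE BFloat16 (roundOdd Binary32 s).toRat).toRat = (roundNE BFloat16 s).toRat :=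
  toRat_roundNE_roundOdd (by decide) (by decide) (by decide +kernel) hs

/-- binary16 via binary32 with round to odd is innocuous (`10 + 2 ≤ 23`). -/
theorem Binary16_via_Binary32_roundOdd {s : ℚ} (hs : |s| ≤ Binary32.maxRat) :
    (roundNE Binary16 (roundOdd Binary32 s).toRat).toRat = (roundNE Binary16 s).toRat :=
  toRat_roundNE_roundOdd (by decide) (by decide) (by decide +kernel) hs

/-- E4M3 via binary32 with round to odd is innocuous. -/
theorem E4M3_via_Binary32_roundOdd {s : ℚ} (hs : |s| ≤ Binary32.maxRat) :
    (roundNE E4M3 (roundOdd Binary32 s).toRat).toRat = (roundNE E4M3 s).toRat :=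
  toRat_roundNE_roundOdd (by decide) (by decide) (by decide +kernel) hs

/-- E5M2 via binary32 with round to odd is innocuous. -/
theorem E5M2_via_Binary32_roundOdd {s : ℚ} (hs : |s| ≤ Binary32.maxRat) :
    (roundNE E5M2 (roundOdd Binary32 s).toRat).toRat = (roundNE E5M2 s).toRat :=
  toRat_roundNE_roundOdd (by decide) (by decide) (by decide +kernel) hs

/-- E2M1 (FP4) via E4M3 with round to odd is innocuous (`1 + 2 ≤ 3`). -/
theorem E2M1_via_E4M3_roundOdd {s : ℚ} (hs : |s| ≤ E4M3.maxRat) :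
    (roundNE E2M1 (roundOdd E4M3 s).toRat).toRat = (roundNE E2M1 s).toRat :=
  toRat_roundNE_roundOdd (by decide) (by decide) (by decide +kernel) hs

/-- E2M1 (FP4) via E5M2 with round to odd is innocuous (`1 + 2 ≤ 2` FAILS — not claimed); via
E3M2 (`1 + 2 ≤ 2` fails) not claimed either; via E2M3 (`1 + 2 ≤ 3`) it holds. -/
theorem E2M1_via_E2M3_roundOdd {s : ℚ} (hs : |s| ≤ E2M3.maxRat) :
    (roundNE E2M1 (roundOdd E2M3 s).toRat).toRat = (roundNE E2M1 s).toRat :=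
  toRat_roundNE_roundOdd (by decide) (by decide) (by decide +kernel) hs

/-- E3M2 / E2M3 (FP6) via bfloat16 with round to odd are innocuous. -/
theorem FP6_via_BFloat16_roundOdd {s : ℚ} (hs : |s| ≤ BFloat16.maxRat) :
    (roundNE E3M2 (roundOdd BFloat16 s).toRat).toRat = (roundNE E3M2 s).toRat ∧
      (roundNE E2M3 (roundOdd BFloat16 s).toRat).toRat = (roundNE E2M3 s).toRat :=
  ⟨toRat_roundNE_roundOdd (by decide) (by decide) (by decide +kernel) hs,
    toRat_roundNE_roundOdd (by decide) (by decide) (by decide +kernel) hs⟩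

/-! ### Kernel replay: the RNE counterexample is repaired -/

/-- THE E4M3-VIA-BFLOAT16 COUNTEREXAMPLE, REPAIRED: for `s = 9/8 + 15/256 = 303/256` (the sum of
the E4M3 data `9/8` and `15/256` of `DoubleRoundingVerdicts.E4M3_add_via_BFloat16_counterexample`)
an RNE bfloat16 intermediate gives the E4M3 midpoint `19/16` and then `5/4`, but round to odd
gives the odd neighbour `151/128`, which E4M3 rounds to the correct `9/8`. Kernel-checked. -/
theorem E4M3_via_BFloat16_roundOdd_witness :
    (roundNE BFloat16 (303 / 256 : ℚ)).toRat = 19 / 16 ∧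
    (roundNE E4M3 (roundNE BFloat16 (303 / 256 : ℚ)).toRat).toRat = 5 / 4 ∧
    (roundOdd BFloat16 (303 / 256 : ℚ)).toRat = 151 / 128 ∧
    (roundNE E4M3 (roundOdd BFloat16 (303 / 256 : ℚ)).toRat).toRat = 9 / 8 ∧
    (roundNE E4M3 (303 / 256 : ℚ)).toRat = 9 / 8 := by
  decide +kernel

end MiniFloat

end Literature.ComputerArithmetic.FloatingPoint
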